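import Summits.RiemannHypothesis.RiemannHypothesis.Theorems.SuzukiStructureFunctionsParity
import Literature.Analysis.Fourier.HolomorphicParamIntegral

/-!
# SuzukiStructureFunctionsEntire — Cor. 3.1 / Thm. 3.1 (1), (3) of Suzuki JFA21: `A(t,·)`, `B(t,·)`,
# `E(t,·) = A(t,·) − iB(t,·)` are REAL ENTIRE functions, `A(t,·)` even, `B(t,·)` odd, `E(t,·)♯ = E(t,−·)`
# (column DBR; RH-FREE)

LINE 1 — LABEL: RH-FREE (for ANY Suzuki pair `(ϱ, K)` on any clean window; no `ζ`, no zeros, no positivity);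
bears_on LADDER-RH B-D → B-P(P1)/(P3): this is the column's de Branges object — on every clean window the
structure function `E(t,·)` of Suzuki's chain is a kernel-checked real entire function with the symmetry of `E`.
WHAT THIS IS NOT: not progress toward RH; `E(t,·) ∈ HB̄` (Suzuki's Prop. 3.4 / Thm. 2.4, needing
`lim_{t→∞} J(t;z,z) = 0`) is NOT claimed — for the `ζ` data as `ω → 0` it is GRH-equivalent; nothing here bears
on the truth of RH.

Source: M. Suzuki, J. Funct. Anal. 281 (2021) 109116 = arXiv:1606.05726 [Suzuki2021Hamiltonians], Cor. 3.1,
Thm. 3.1 (1), (3), eq. (3.40).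

Contents (seat rh-dbr-eng-5 g7; continuation of `SuzukiStructureFunctionsParity`):
* `differentiable_fourier_of_decay` — super-exponential decay ⇒ `𝖥f` entire (dominated holomorphic dependence,
  the tree's `differentiableOn_integral_of_dominated_holomorphic`);
* `differentiable_frakA/frakB/structA/structB/structE` — **Cor. 3.1 / Thm. 3.1 (1)**: entire in `z`;
* `frakA_neg`, `frakB_neg`, `structA_neg`, `structB_neg` — **Thm. 3.1 (3)**: `A(t,−z) = A(t,z)`, `B(t,−z) = −B(t,z)`;
* `sharp_frakA`, `sharp_frakB`, `sharp_structA`, `sharp_structB` — **real** entire (`F♯ = F`), hence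
  `structA_ofReal_im`, `structB_ofReal_im` (real on `ℝ`); `sharp_structE` — `E(t,·)♯ = E(t,−·)`;
* §9 **eq. (3.40)** `structA_eq_cos_integral` (`A(t,z) = ∫ F(t,x)cos(zx) dx`), `structB_eq_neg_sin_integral`
  (`B(t,z) = −∫ G(t,x)sin(zx) dx`), via `fourier_eq_cos_integral_of_even` / `fourier_eq_sin_integral_of_odd`.
DECLARED RESIDUAL of this corpus (not typed as a target here; RH-FREE·FORMALISATION-OPEN, an analysis debt,
NOT RH-hard): Thm. 3.1 (2) (continuity/piecewise-`C¹` in `t`, Lemmas 3.5–3.6 via Fredholm minors) and (4)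
(the canonical system `−d/dt (A,B)ᵀ = z [[0,−1],[1,0]] H(t) (A,B)ᵀ`, via the first-order system (3.25)).
-/

noncomputable section

-- D-0017: `Summit.<S>.<S>.…` is the designed namespace of a single-problem summit.
set_option linter.dupNamespace false

open MeasureTheory Set Complex Filter Topology Metric
open scoped ComplexConjugate

namespace Summit.RiemannHypothesis.RiemannHypothesis.Theorems.SuzukiStructureFunctions

open Literature.NumberTheory.LFunctions Literature.NumberTheory.LFunctions.SuzukiStructure
open Literature.Analysis.DeBrangesSpaces (sharp sharp_apply)

variable {ϱ K : ℝ → ℝ} {ε t : ℝ}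

/-! ## §8 Cor. 3.1 / Thm. 3.1 (1), (3): `A(t,·)`, `B(t,·)`, `E(t,·)` are real entire functions; `A` even, `B` odd -/

/-- RH-FREE. **Super-exponential decay ⇒ `𝖥f` is entire** (holomorphic dependence of `∫ f(x)e^{izx} dx` on
`z`, dominated on every disc `|z| < R` by `|f(x)|e^{R|x|} ≤ C e^{−|x|}`). -/
theorem differentiable_fourier_of_decay {f : ℝ → ℝ} (hf : Continuous f)
    (hdec : ∀ n : ℝ, ∃ C : ℝ, ∀ x : ℝ, |f x| ≤ C * Real.exp (-(n * |x|))) :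
    Differentiable ℂ (fourier f) := by
  intro z₀
  set R : ℝ := ‖z₀‖ + 1 with hR
  have hmem : z₀ ∈ ball (0 : ℂ) R := by
    rw [mem_ball, dist_zero_right, hR]; exact lt_add_one _
  suffices hd : DifferentiableOn ℂ (fourier f) (ball (0 : ℂ) R) from
    hd.differentiableAt (isOpen_ball.mem_nhds hmem)
  obtain ⟨C, hC⟩ := hdec (R + 1)
  have e : fourier f = fun w : ℂ => ∫ x : ℝ, (f x : ℂ) * cexp (I * w * x) := by
    funext w; rfl
  rw [e]
  refine Literature.Analysis.Fourier.differentiableOn_integral_of_dominated_holomorphic isOpen_ball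
    (K := fun (w : ℂ) (x : ℝ) => (f x : ℂ) * cexp (I * w * x)) (B := fun x => C * Real.exp (-1 * |x|))
    (fun w _ => ?_) (Eventually.of_forall fun x => ?_) (Eventually.of_forall fun x w hw => ?_)
    ((Literature.Analysis.Complex.integrable_exp_neg_mul_abs one_pos).const_mul C)
  · exact Continuous.aestronglyMeasurable (by fun_prop)
  · exact (((differentiable_const _).mul ((((differentiable_const I).mul differentiable_id).mul
      (differentiable_const _)).cexp)).differentiableOn)
  · rw [mem_ball, dist_zero_right] at hw
    rw [norm_mul, Complex.norm_real, Real.norm_eq_abs]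
    have him : |w.im| ≤ R := (abs_im_le_norm w).trans hw.le
    calc |f x| * ‖cexp (I * w * x)‖ ≤ C * Real.exp (-((R + 1) * |x|)) * Real.exp (|w.im| * |x|) :=
          mul_le_mul (hC x) (norm_cexp_I_mul_le w x) (norm_nonneg _) ((abs_nonneg _).trans (hC x))
      _ ≤ C * Real.exp (-((R + 1) * |x|)) * Real.exp (R * |x|) := by
          have hC0 : 0 ≤ C := by
            have := (abs_nonneg _).trans (hC 0)
            simpa using this
          gcongr
      _ = C * Real.exp (-1 * |x|) := by
          rw [mul_assoc, ← Real.exp_add]; congr 2; ring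

/-- RH-FREE. `𝖥(−f) = −𝖥f` (no integrability needed). -/
theorem fourier_neg_fun (f : ℝ → ℝ) (z : ℂ) : fourier (fun x => -f x) z = -fourier f z := by
  rw [fourier_def, fourier_def, ← integral_neg]
  refine integral_congr_ae (Eventually.of_forall fun x => ?_)
  push_cast
  ring

/-- RH-FREE. `𝖥` of an even real function is even: `f(−x) = f(x)` ⇒ `(𝖥f)(−z) = (𝖥f)(z)`. -/
theorem fourier_neg_of_even {f : ℝ → ℝ} (hf : ∀ x, f (-x) = f x) (z : ℂ) : fourier f (-z) = fourier f z := by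
  rw [← fourier_comp_neg]
  exact congrArg (fun g => fourier g z) (funext hf)

/-- RH-FREE. `𝖥` of an odd real function is odd: `f(−x) = −f(x)` ⇒ `(𝖥f)(−z) = −(𝖥f)(z)`. -/
theorem fourier_neg_of_odd {f : ℝ → ℝ} (hf : ∀ x, f (-x) = -f x) (z : ℂ) : fourier f (-z) = -fourier f z := by
  rw [← fourier_comp_neg, ← fourier_neg_fun]
  exact congrArg (fun g => fourier g z) (funext hf)

/-- RH-FREE. **Cor. 3.1: `𝔄(t,·)` is entire** (on a solvable `φ⁺`-window). -/
theorem differentiable_frakA (h : IsSuzukiPair ϱ K) (hsol : ∃ X : ℝ → ℝ, IsSuzukiPhiSolution K 1 t X) :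
    Differentiable ℂ (frakA ϱ K t) :=
  differentiable_fourier_of_decay (continuous_frakFG h hsol) (frakFG_decay h hsol)

/-- RH-FREE. **Cor. 3.1: `𝔅(t,·)` is entire** (on a solvable `φ⁻`-window). -/
theorem differentiable_frakB (h : IsSuzukiPair ϱ K) (hsol : ∃ X : ℝ → ℝ, IsSuzukiPhiSolution K (-1) t X) :
    Differentiable ℂ (frakB ϱ K t) :=
  (differentiable_const I).mul (differentiable_fourier_of_decay (continuous_frakFG h hsol) (frakFG_decay h hsol))

/-- RH-FREE. **Thm. 3.1 (1): `A(t,·)` is entire.** -/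
theorem differentiable_structA (h : IsSuzukiPair ϱ K) (hsol : ∃ X : ℝ → ℝ, IsSuzukiPhiSolution K 1 t X) :
    Differentiable ℂ (structA ϱ K t) :=
  (differentiable_const _).mul (differentiable_frakA h hsol)

/-- RH-FREE. **Thm. 3.1 (1): `B(t,·)` is entire.** -/
theorem differentiable_structB (h : IsSuzukiPair ϱ K) (hsol : ∃ X : ℝ → ℝ, IsSuzukiPhiSolution K (-1) t X) :
    Differentiable ℂ (structB ϱ K t) :=
  (differentiable_const _).mul (differentiable_frakB h hsol)

/-- RH-FREE. **`E(t,·) = A(t,·) − iB(t,·)` is entire** (Thm. 3.1 (1) with (3.39)), on a clean window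
(both `φ^{±}`-equations solvable). -/
theorem differentiable_structE (h : IsSuzukiPair ϱ K) (hp : ∃ X : ℝ → ℝ, IsSuzukiPhiSolution K 1 t X)
    (hm : ∃ X : ℝ → ℝ, IsSuzukiPhiSolution K (-1) t X) : Differentiable ℂ (structE ϱ K t) :=
  (differentiable_structA h hp).sub ((differentiable_const I).mul (differentiable_structB h hm))

/-- RH-FREE. **Cor. 3.1 / Thm. 3.1 (3): `𝔄(t,·)` is even**, `𝔄(t,−z) = 𝔄(t,z)`. -/
theorem frakA_neg (h : IsSuzukiPair ϱ K) (hsol : ∃ X : ℝ → ℝ, IsSuzukiPhiSolution K 1 t X) (z : ℂ) :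
    frakA ϱ K t (-z) = frakA ϱ K t z :=
  fourier_neg_of_even (frakF_neg h hsol) z

/-- RH-FREE. **Cor. 3.1 / Thm. 3.1 (3): `𝔅(t,·)` is odd**, `𝔅(t,−z) = −𝔅(t,z)`. -/
theorem frakB_neg (h : IsSuzukiPair ϱ K) (hsol : ∃ X : ℝ → ℝ, IsSuzukiPhiSolution K (-1) t X) (z : ℂ) :
    frakB ϱ K t (-z) = -frakB ϱ K t z := by
  rw [frakB_def, frakB_def, fourier_neg_of_odd (frakG_neg h hsol) z, mul_neg]

/-- RH-FREE. **Thm. 3.1 (3): `A(t,−z) = A(t,z)`.** -/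
theorem structA_neg (h : IsSuzukiPair ϱ K) (hsol : ∃ X : ℝ → ℝ, IsSuzukiPhiSolution K 1 t X) (z : ℂ) :
    structA ϱ K t (-z) = structA ϱ K t z := by
  rw [structA_def, structA_def, frakA_neg h hsol z]

/-- RH-FREE. **Thm. 3.1 (3): `B(t,−z) = −B(t,z)`.** -/
theorem structB_neg (h : IsSuzukiPair ϱ K) (hsol : ∃ X : ℝ → ℝ, IsSuzukiPhiSolution K (-1) t X) (z : ℂ) :
    structB ϱ K t (-z) = -structB ϱ K t z := by
  rw [structB_def, structB_def, frakB_neg h hsol z, mul_neg]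

/-- RH-FREE. **Cor. 3.1: `𝔄(t,·)` is a REAL entire function**, `𝔄♯ = 𝔄` (`♯` = conjugate reflection
`Literature.Analysis.DeBrangesSpaces.sharp`). -/
theorem sharp_frakA (h : IsSuzukiPair ϱ K) (hsol : ∃ X : ℝ → ℝ, IsSuzukiPhiSolution K 1 t X) (z : ℂ) :
    sharp (frakA ϱ K t) z = frakA ϱ K t z := by
  rw [show frakA ϱ K t = fourier (frakF ϱ K t) from rfl, sharp_fourier, fourier_neg_of_even (frakF_neg h hsol)]

/-- RH-FREE. **Cor. 3.1: `𝔅(t,·)` is a REAL entire function**, `𝔅♯ = 𝔅`. -/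
theorem sharp_frakB (h : IsSuzukiPair ϱ K) (hsol : ∃ X : ℝ → ℝ, IsSuzukiPhiSolution K (-1) t X) (z : ℂ) :
    sharp (frakB ϱ K t) z = frakB ϱ K t z := by
  rw [sharp_apply, frakB_def, frakB_def, map_mul, Complex.conj_I]
  have hs := sharp_fourier (frakG ϱ K t) z
  rw [sharp_apply] at hs
  rw [hs, fourier_neg_of_odd (frakG_neg h hsol) z]
  ring

/-- RH-FREE. **Thm. 3.1 (1): `A(t,·)` is real entire**, `A(t,·)♯ = A(t,·)`. -/
theorem sharp_structA (h : IsSuzukiPair ϱ K) (hsol : ∃ X : ℝ → ℝ, IsSuzukiPhiSolution K 1 t X) (z : ℂ) :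
    sharp (structA ϱ K t) z = structA ϱ K t z := by
  have hs := sharp_frakA h hsol z
  rw [sharp_apply] at hs ⊢
  rw [structA_def, structA_def, map_mul, Complex.conj_ofReal, hs]

/-- RH-FREE. **Thm. 3.1 (1): `B(t,·)` is real entire**, `B(t,·)♯ = B(t,·)`. -/
theorem sharp_structB (h : IsSuzukiPair ϱ K) (hsol : ∃ X : ℝ → ℝ, IsSuzukiPhiSolution K (-1) t X) (z : ℂ) :
    sharp (structB ϱ K t) z = structB ϱ K t z := by
  have hs := sharp_frakB h hsol z
  rw [sharp_apply] at hs ⊢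
  rw [structB_def, structB_def, map_mul, Complex.conj_ofReal, hs]

/-- RH-FREE. **`E(t,·)♯ = A(t,·) + iB(t,·) = E(t,−·)`** — the structure function of the chain has the symmetry
`E♯(z) = E(−z)` of the initial `E` («we have `E♯(z) = E(−z)` from (K1)»), on every clean window. -/
theorem sharp_structE (h : IsSuzukiPair ϱ K) (hp : ∃ X : ℝ → ℝ, IsSuzukiPhiSolution K 1 t X)
    (hm : ∃ X : ℝ → ℝ, IsSuzukiPhiSolution K (-1) t X) (z : ℂ) :
    sharp (structE ϱ K t) z = structE ϱ K t (-z) := by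
  have hA := sharp_structA h hp z
  have hB := sharp_structB h hm z
  rw [sharp_apply] at hA hB ⊢
  rw [structE_def, structE_def, map_sub, map_mul, Complex.conj_I, hA, hB, structA_neg h hp, structB_neg h hm]
  ring

/-- RH-FREE. `A(t,x)` and `B(t,x)` are REAL for real `x` (real entire functions on the real axis). -/
theorem structA_ofReal_im (h : IsSuzukiPair ϱ K) (hsol : ∃ X : ℝ → ℝ, IsSuzukiPhiSolution K 1 t X) (x : ℝ) :
    (structA ϱ K t x).im = 0 := by
  have hs := sharp_structA h hsol x
  rw [Literature.Analysis.DeBrangesSpaces.sharp_ofReal] at hs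
  exact Complex.conj_eq_iff_im.1 hs

/-- RH-FREE. `B(t,x)` is real for real `x`. -/
theorem structB_ofReal_im (h : IsSuzukiPair ϱ K) (hsol : ∃ X : ℝ → ℝ, IsSuzukiPhiSolution K (-1) t X) (x : ℝ) :
    (structB ϱ K t x).im = 0 := by
  have hs := sharp_structB h hsol x
  rw [Literature.Analysis.DeBrangesSpaces.sharp_ofReal] at hs
  exact Complex.conj_eq_iff_im.1 hs

/-! ## §9 Eq. (3.40): `A(t,z) = ∫ F(t,x) cos(zx) dx`, `B(t,z) = −∫ G(t,x) sin(zx) dx` -/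

/-- RH-FREE. `𝖥` of an even, absolutely transformable real function is a cosine transform:
`(𝖥f)(z) = ∫ f(x) cos(zx) dx`. -/
theorem fourier_eq_cos_integral_of_even {f : ℝ → ℝ} (hf : ∀ x, f (-x) = f x)
    (hint : ∀ z : ℂ, Integrable fun x : ℝ => (f x : ℂ) * cexp (I * z * x)) (z : ℂ) :
    fourier f z = ∫ x : ℝ, (f x : ℂ) * Complex.cos (z * x) := by
  have key : ∀ w : ℂ, cexp (I * w) + cexp (I * -w) = 2 * Complex.cos w := by
    intro w
    rw [show I * w = w * I by ring, show I * -w = (-w) * I by ring, Complex.exp_mul_I, Complex.exp_mul_I,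
      Complex.cos_neg, Complex.sin_neg]
    ring
  have h1 : fourier f z + fourier f (-z) = ∫ x : ℝ, (f x : ℂ) * (2 * Complex.cos (z * x)) := by
    rw [fourier_def, fourier_def, ← integral_add (hint z) (hint (-z))]
    refine integral_congr_ae (Eventually.of_forall fun x => ?_)
    simp only
    rw [← mul_add, show I * z * (x : ℂ) = I * (z * x) by ring, show I * -z * (x : ℂ) = I * -(z * x) by ring,
      key]
  rw [fourier_neg_of_even hf] at h1
  have h2 : fourier f z = (1 / 2 : ℂ) * ∫ x : ℝ, (f x : ℂ) * (2 * Complex.cos (z * x)) := by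
    rw [← h1]; ring
  rw [h2, ← integral_const_mul]
  refine integral_congr_ae (Eventually.of_forall fun x => ?_)
  simp only
  ring

/-- RH-FREE. `𝖥` of an odd, absolutely transformable real function is `i` times a sine transform:
`(𝖥f)(z) = i ∫ f(x) sin(zx) dx`. -/
theorem fourier_eq_sin_integral_of_odd {f : ℝ → ℝ} (hf : ∀ x, f (-x) = -f x)
    (hint : ∀ z : ℂ, Integrable fun x : ℝ => (f x : ℂ) * cexp (I * z * x)) (z : ℂ) :
    fourier f z = I * ∫ x : ℝ, (f x : ℂ) * Complex.sin (z * x) := by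
  have key : ∀ w : ℂ, cexp (I * w) - cexp (I * -w) = 2 * I * Complex.sin w := by
    intro w
    rw [show I * w = w * I by ring, show I * -w = (-w) * I by ring, Complex.exp_mul_I, Complex.exp_mul_I,
      Complex.cos_neg, Complex.sin_neg]
    ring
  have h1 : fourier f z - fourier f (-z) = ∫ x : ℝ, (f x : ℂ) * (2 * I * Complex.sin (z * x)) := by
    rw [fourier_def, fourier_def, ← integral_sub (hint z) (hint (-z))]
    refine integral_congr_ae (Eventually.of_forall fun x => ?_)
    simp only
    rw [← mul_sub, show I * z * (x : ℂ) = I * (z * x) by ring, show I * -z * (x : ℂ) = I * -(z * x) by ring,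
      key]
  rw [fourier_neg_of_odd hf, sub_neg_eq_add] at h1
  have h2 : fourier f z = (1 / 2 : ℂ) * ∫ x : ℝ, (f x : ℂ) * (2 * I * Complex.sin (z * x)) := by
    rw [← h1]; ring
  rw [h2, ← integral_const_mul, ← integral_const_mul]
  refine integral_congr_ae (Eventually.of_forall fun x => ?_)
  simp only
  ring

/-- RH-FREE. **Eq. (3.40), first half: `A(t,z) = ∫ F(t,x) cos(zx) dx`** with `F(t,x) = m(t)𝔉(t,x)` (3.36), on a
solvable `φ⁺`-window. -/
theorem structA_eq_cos_integral (h : IsSuzukiPair ϱ K) (hsol : ∃ X : ℝ → ℝ, IsSuzukiPhiSolution K 1 t X)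
    (z : ℂ) : structA ϱ K t z = ∫ x : ℝ, (bigF ϱ K t x : ℂ) * Complex.cos (z * x) := by
  rw [structA_def, frakA_def, fourier_eq_cos_integral_of_even (frakF_neg h hsol)
    (fun w => integrable_frakFG_mul_cexp h hsol w) z, ← integral_const_mul]
  refine integral_congr_ae (Eventually.of_forall fun x => ?_)
  simp only [bigF_def]
  push_cast
  ring

/-- RH-FREE. **Eq. (3.40), second half: `B(t,z) = −∫ G(t,x) sin(zx) dx`** with `G(t,x) = m(t)⁻¹𝔊(t,x)` (3.36), on a
solvable `φ⁻`-window. -/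
theorem structB_eq_neg_sin_integral (h : IsSuzukiPair ϱ K) (hsol : ∃ X : ℝ → ℝ, IsSuzukiPhiSolution K (-1) t X)
    (z : ℂ) : structB ϱ K t z = -∫ x : ℝ, (bigG ϱ K t x : ℂ) * Complex.sin (z * x) := by
  rw [structB_def, frakB_def, fourier_eq_sin_integral_of_odd (frakG_neg h hsol)
    (fun w => integrable_frakFG_mul_cexp h hsol w) z, ← mul_assoc, ← mul_assoc,
    show ((m K t)⁻¹ : ℝ) * I * I = -(((m K t)⁻¹ : ℝ) : ℂ) by rw [mul_assoc, I_mul_I]; ring,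
    neg_mul, ← integral_const_mul]
  congr 1
  refine integral_congr_ae (Eventually.of_forall fun x => ?_)
  simp only [bigG_def]
  push_cast
  ring

end Summit.RiemannHypothesis.RiemannHypothesis.Theorems.SuzukiStructureFunctions

end
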